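import Summits.Ventures.HodgeRepro.TwistedQuadIINegModel

/-!
# Theorem T sub-case (ii), `ε = +`: the model `(ℤ/2k × ℤ/2) ⋊ ℤ/2` with `s = +1`, in coordinates

Blind re-derivation cell `pub-hodge-repro`, seat `p1` (gen 12).  The sign `s = +1` on `ℤ/2k` (`u v u⁻¹ = c v`),
the model `HP k` of `TwistedQuadIICore` for it, the coordinate rules `mkP a e 0 · mkP b f h`, `mkP a e 1 · mkP b f h`,
the four twists `1, u, v, vu` and their inverses in coordinates (`(vu)⁻¹ = mkP (−1) 1 1`), `p · c`, the value
arithmetic `(a ± 1).val` in `ℤ/2k`, and the four neighbours `p t_i⁻¹` of every point `p = mkP a e g` — the set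
`{mkP a e 0, mkP a e 1, mkP (a − 1) e 0, mkP (a − 1) (e + 1) 1}` for both `g`.  Pattern-independent; the family and
the theorem are in `TwistedQuadIIPos`.  (The twin of `TwistedQuadIINegModel`, which it imports for `hm2`, `one_le_k`,
`two_k_cast`, `par_zero`, `par_one`, `two_zmod_two'`; names carry `P`.)
-/

set_option autoImplicit false

open Finset Multiplicative
open scoped Pointwise

namespace HodgeRepro.TwistedQuadIIGen

open HodgeRepro.CosetQuad

variable (k : ℕ) [NeZero k]

/-! ### The sign `s = +1` on `ℤ/2k` -/

/-- `s = 1`. -/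
def sP : ZMod (2 * k) := 1

omit [NeZero k] in
/-- `s² = 1`. -/
theorem sP_sq : sP k * sP k = 1 := by rw [sP, one_mul]

/-- `s.val = 1`. -/
theorem sP_val : (sP k).val = 1 := by
  haveI : Fact (1 < 2 * k) := ⟨by have := one_le_k k; omega⟩
  rw [sP, ZMod.val_one]

/-- `s` is odd. -/
theorem sP_odd : (sP k).val % 2 = 1 := by rw [sP_val]

omit [NeZero k] in
/-- `s · b = b`. -/
theorem sP_mul (b : ZMod (2 * k)) : sP k * b = b := by rw [sP, one_mul]

/-- `−1 = ((2k − 1 : ℕ) : ℤ/2k)`. -/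
theorem neg_one_eq : (-1 : ZMod (2 * k)) = ((2 * k - 1 : ℕ) : ZMod (2 * k)) := by
  have hk := one_le_k k
  symm
  apply eq_neg_of_add_eq_zero_left
  rw [← Nat.cast_succ, Nat.succ_eq_add_one, show 2 * k - 1 + 1 = 2 * k by omega, two_k_cast]

/-- `(−1).val = 2k − 1`. -/
theorem val_neg_one : (-1 : ZMod (2 * k)).val = 2 * k - 1 := by
  have hk := one_le_k k
  rw [neg_one_eq, ZMod.val_natCast_of_lt (by omega)]

/-- The model for `ε = +`. -/
abbrev HP : Type := HGen (2 * k) (hm2 k) (sP k) (sP_sq k) (sP_odd k)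

/-- Coordinates on `HP`. -/
abbrev mkP (a : ZMod (2 * k)) (e g : ZMod 2) : HP k := mkII (2 * k) (hm2 k) (sP k) (sP_sq k) (sP_odd k) a e g

/-! ### Coordinates -/

/-- `1 = mkP 0 0 0`. -/
theorem one_eq_mkP : (1 : HP k) = mkP k 0 0 0 := rfl

/-- Multiplication by a `⟨v, c⟩`-point. -/
theorem mkP_mul_zero (a b : ZMod (2 * k)) (e f h : ZMod 2) :
    mkP k a e 0 * mkP k b f h = mkP k (a + b) (e + f) h := by
  refine SemidirectProduct.ext ?_ ?_
  · show (ofAdd a, ofAdd e) * (phiII (2 * k) (hm2 k) (sP k) (sP_sq k) (sP_odd k) (ofAdd 0)) (ofAdd b, ofAdd f) =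
      (ofAdd (a + b), ofAdd (e + f))
    rw [phiII_zero, MulAut.one_apply, Prod.mk_mul_mk, ← ofAdd_add, ← ofAdd_add]
  · show ofAdd (0 : ZMod 2) * ofAdd h = ofAdd h
    rw [← ofAdd_add, zero_add]

/-- Multiplication by a `u`-coset point. -/
theorem mkP_mul_one (a b : ZMod (2 * k)) (e f h : ZMod 2) :
    mkP k a e 1 * mkP k b f h = mkP k (a + sP k * b) (e + (par (2 * k) b + f)) (1 + h) := by
  refine SemidirectProduct.ext ?_ ?_
  · show (ofAdd a, ofAdd e) * (phiII (2 * k) (hm2 k) (sP k) (sP_sq k) (sP_odd k) (ofAdd 1)) (ofAdd b, ofAdd f) =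
      (ofAdd (a + sP k * b), ofAdd (e + (par (2 * k) b + f)))
    rw [phiII_one, tauII_apply, tauFun, toAdd_ofAdd, toAdd_ofAdd, Prod.mk_mul_mk, ← ofAdd_add, ← ofAdd_add]
  · show ofAdd (1 : ZMod 2) * ofAdd h = ofAdd (1 + h)
    rw [← ofAdd_add]

/-- `par (−1) = 1`. -/
theorem par_neg_one_pos : par (2 * k) (-1) = 1 := by
  have hk := one_le_k k
  rw [par, val_neg_one, ← ZMod.natCast_mod, show (2 * k - 1) % 2 = 1 by omega, Nat.cast_one]

/-- The four twists in coordinates. -/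
theorem rectT_eq_pos :
    rectTII (2 * k) (hm2 k) (sP k) (sP_sq k) (sP_odd k) 0 = mkP k 0 0 0 ∧
    rectTII (2 * k) (hm2 k) (sP k) (sP_sq k) (sP_odd k) 1 = mkP k 0 0 1 ∧
    rectTII (2 * k) (hm2 k) (sP k) (sP_sq k) (sP_odd k) 2 = mkP k 1 0 0 ∧
    rectTII (2 * k) (hm2 k) (sP k) (sP_sq k) (sP_odd k) 3 = mkP k 1 0 1 := by
  refine ⟨rfl, rfl, rfl, ?_⟩
  show vII (2 * k) (hm2 k) (sP k) (sP_sq k) (sP_odd k) * uII (2 * k) (hm2 k) (sP k) (sP_sq k) (sP_odd k) = mkP k 1 0 1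
  rw [vII, uII, mkP_mul_zero, add_zero, add_zero]

/-- The inverses of the four twists: `1, u, v⁻¹ = mkP (−1) 0 0, (vu)⁻¹ = mkP (−1) 1 1`. -/
theorem rectT_inv_pos :
    (rectTII (2 * k) (hm2 k) (sP k) (sP_sq k) (sP_odd k) 0)⁻¹ = mkP k 0 0 0 ∧
    (rectTII (2 * k) (hm2 k) (sP k) (sP_sq k) (sP_odd k) 1)⁻¹ = mkP k 0 0 1 ∧
    (rectTII (2 * k) (hm2 k) (sP k) (sP_sq k) (sP_odd k) 2)⁻¹ = mkP k (-1) 0 0 ∧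
    (rectTII (2 * k) (hm2 k) (sP k) (sP_sq k) (sP_odd k) 3)⁻¹ = mkP k (-1) 1 1 := by
  obtain ⟨r0, r1, r2, r3⟩ := rectT_eq_pos k
  refine ⟨?_, ?_, ?_, ?_⟩
  · rw [r0, ← one_eq_mkP, inv_one]
  · rw [r1]
    apply inv_eq_of_mul_eq_one_right
    rw [mkP_mul_one, mul_zero, add_zero, par_zero, add_zero, add_zero, two_zmod_two', one_eq_mkP]
  · rw [r2]
    apply inv_eq_of_mul_eq_one_right
    rw [mkP_mul_zero, add_neg_cancel, add_zero, one_eq_mkP]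
  · rw [r3]
    apply inv_eq_of_mul_eq_one_right
    rw [mkP_mul_one, sP_mul, add_neg_cancel, par_neg_one_pos, zero_add, two_zmod_two', one_eq_mkP]

/-- `c = mkP 0 1 0`, and `p c` in coordinates. -/
theorem mkP_mul_c (a : ZMod (2 * k)) (e g : ZMod 2) :
    mkP k a e g * cII (2 * k) (hm2 k) (sP k) (sP_sq k) (sP_odd k) = mkP k a (e + 1) g := by
  rcases (show ∀ y : ZMod 2, y = 0 ∨ y = 1 by decide) g with rfl | rfl
  · show mkP k a e 0 * mkP k 0 1 0 = mkP k a (e + 1) 0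
    rw [mkP_mul_zero, add_zero]
  · show mkP k a e 1 * mkP k 0 1 0 = mkP k a (e + 1) 1
    rw [mkP_mul_one, mul_zero, add_zero, par_zero, zero_add, add_zero]

/-! ### Value arithmetic in `ℤ/2k` -/

/-- `(a + 1).val`. -/
theorem val_add_one_pos (a : ZMod (2 * k)) :
    (a + 1).val = if a.val + 1 < 2 * k then a.val + 1 else 0 := by
  haveI : Fact (1 < 2 * k) := ⟨by have := one_le_k k; omega⟩
  have hv : a.val < 2 * k := ZMod.val_lt a
  rw [ZMod.val_add, ZMod.val_one]
  split_ifs with h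
  · exact Nat.mod_eq_of_lt h
  · rw [show a.val + 1 = 2 * k by omega, Nat.mod_self]

/-- `(a − 1).val`. -/
theorem val_sub_one_pos (a : ZMod (2 * k)) :
    (a - 1).val = if a.val = 0 then 2 * k - 1 else a.val - 1 := by
  have hk := one_le_k k
  have hv : a.val < 2 * k := ZMod.val_lt a
  rw [sub_eq_add_neg, ZMod.val_add, val_neg_one]
  split_ifs with h
  · rw [h, zero_add, Nat.mod_eq_of_lt (by omega)]
  · rw [show a.val + (2 * k - 1) = (a.val - 1) + 1 * (2 * k) by omega, Nat.add_mul_mod_self_right,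
      Nat.mod_eq_of_lt (by omega)]

/-! ### The four neighbours -/

/-- The four neighbours `p t_i⁻¹` of `p = mkP a e g`, as a set: `{mkP a e 0, mkP a e 1, mkP (a − 1) e 0,
mkP (a − 1) (e + 1) 1}` (in the order `0, 1, 2, 3` for `g = 0` and `1, 0, 3, 2` for `g = 1`). -/
theorem nbrs_zero_pos (a : ZMod (2 * k)) (e : ZMod 2) :
    mkP k a e 0 * (rectTII (2 * k) (hm2 k) (sP k) (sP_sq k) (sP_odd k) 0)⁻¹ = mkP k a e 0 ∧
    mkP k a e 0 * (rectTII (2 * k) (hm2 k) (sP k) (sP_sq k) (sP_odd k) 1)⁻¹ = mkP k a e 1 ∧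
    mkP k a e 0 * (rectTII (2 * k) (hm2 k) (sP k) (sP_sq k) (sP_odd k) 2)⁻¹ = mkP k (a - 1) e 0 ∧
    mkP k a e 0 * (rectTII (2 * k) (hm2 k) (sP k) (sP_sq k) (sP_odd k) 3)⁻¹ = mkP k (a - 1) (e + 1) 1 := by
  obtain ⟨i0, i1, i2, i3⟩ := rectT_inv_pos k
  refine ⟨?_, ?_, ?_, ?_⟩
  · rw [i0, mkP_mul_zero, add_zero, add_zero]
  · rw [i1, mkP_mul_zero, add_zero, add_zero]
  · rw [i2, mkP_mul_zero, add_zero, sub_eq_add_neg]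
  · rw [i3, mkP_mul_zero, sub_eq_add_neg]

/-- The same for `g = 1`. -/
theorem nbrs_one_pos (a : ZMod (2 * k)) (e : ZMod 2) :
    mkP k a e 1 * (rectTII (2 * k) (hm2 k) (sP k) (sP_sq k) (sP_odd k) 0)⁻¹ = mkP k a e 1 ∧
    mkP k a e 1 * (rectTII (2 * k) (hm2 k) (sP k) (sP_sq k) (sP_odd k) 1)⁻¹ = mkP k a e 0 ∧
    mkP k a e 1 * (rectTII (2 * k) (hm2 k) (sP k) (sP_sq k) (sP_odd k) 2)⁻¹ = mkP k (a - 1) (e + 1) 1 ∧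
    mkP k a e 1 * (rectTII (2 * k) (hm2 k) (sP k) (sP_sq k) (sP_odd k) 3)⁻¹ = mkP k (a - 1) e 0 := by
  obtain ⟨i0, i1, i2, i3⟩ := rectT_inv_pos k
  refine ⟨?_, ?_, ?_, ?_⟩
  · rw [i0, mkP_mul_one, mul_zero, add_zero, par_zero, add_zero, add_zero, add_zero]
  · rw [i1, mkP_mul_one, mul_zero, add_zero, par_zero, add_zero, add_zero, two_zmod_two']
  · rw [i2, mkP_mul_one, sP_mul, ← sub_eq_add_neg, par_neg_one_pos, add_zero]
  · rw [i3, mkP_mul_one, sP_mul, ← sub_eq_add_neg, par_neg_one_pos, ← add_assoc, two_zmod_two', add_assoc,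
      two_zmod_two', add_zero]

end HodgeRepro.TwistedQuadIIGen
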